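import Literature.Analysis.Matrix.SparseLUSplitVerification
import HarnessLib

/-!
# (1.8) with a symmetrised majorant and a Collatz vector — the `passes ≥ 2` floor of `cap.ila.mfldl`

Topic `Analysis/Matrix`; namespace `Literature.Analysis.Matrix.SparseLUSplit` (same as the host lemma).
HONEST FRAMING (cell certnum, D-0105 (6); layer L1/L4; seat certnum-ila-1, author of `cap.ila.mfldl`):
a typed and PROVED corollary of the tree's (1.8)
`SparseLUSplit.norm_toLp_mulVec_le_sqrt_of_abs_le_collatz` [cite: Rump2026SparseI, (1.8) p. 6]; it
certifies no engine output. 0 definitions, 0 named facts, 0 `sorry`.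

WHAT THE KERNEL DOES (cap.ila 0.2.1.dev40+, `mfldl.factor_aug(x=…)`, `sigma_min_lower_aug(mf_kwargs=
{'passes': k})`): the residual `Δ := H(p,p) − G·diag(s)·Gᵀ` is SYMMETRIC; the front-local bookkeeping
yields an entrywise majorant `W ≥ |Δ|` that is NOT symmetric (it is a sum of one-sided rounding bounds),
of which only the vectors `W·x` and `Wᵀ·x` are ever formed, for a positive Collatz vector `x` (the first
pass uses `x = 1`, a later pass the previous pass's `(W + Wᵀ)x/2`). The kernel then claims
`‖Δ‖₂ ≤ ρ` with `ρ := max_i ((W + Wᵀ)x)_i / (2 x_i)`. This file is exactly that step: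
* `abs_le_half_add_transpose_of_symm` — `|Δ| ≤ W` entrywise and `Δᵀ = Δ` give `|Δ| ≤ (W + Wᵀ)/2`;
* `norm_toLp_mulVec_le_of_symm_collatz` — if moreover `x > 0`, `0 ≤ ρ` and `((W + Wᵀ)x)_i ≤ 2ρ·x_i`
  for all `i`, then `‖Δv‖₂ ≤ ρ‖v‖₂` for every `v` ((1.8) applied to the symmetric nonneg majorant
  `S := (W + Wᵀ)/2` with `θ := ρ²`: `Sᵀ(Sx) = S(Sx) ≤ S(ρx) = ρ·Sx ≤ ρ²x` by entrywise monotonicity).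
WHAT IS NOT CERTIFIED: how `W·x`, `Wᵀ·x` are obtained in floating point (upward bookkeeping under
H-IEEE / H-BLAS inside `cap.ila.mfldl` — hypotheses of the certificate, not of this file).
-/

open Finset Matrix WithLp

namespace Literature.Analysis.Matrix.SparseLUSplit

variable {n : ℕ}

/-- A symmetric matrix dominated entrywise by `W` is dominated by the symmetrised majorant
`(W + Wᵀ)/2` (the step that lets `cap.ila.mfldl` work with row AND column sums of a one-sided bound).
[cite: Rump2026SparseI, (1.8)–(1.9) p. 6] -/
theorem abs_le_half_add_transpose_of_symm {Δ W : Matrix (Fin n) (Fin n) ℝ} (hΔ : Δᵀ = Δ)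
    (hW : ∀ i j, |Δ i j| ≤ W i j) (i j : Fin n) :
    |Δ i j| ≤ ((W + Wᵀ) i j) / 2 := by
  have h1 : |Δ i j| ≤ W i j := hW i j
  have h2 : |Δ i j| ≤ W j i := by
    have := hW j i
    rwa [← Matrix.transpose_apply Δ i j, hΔ] at this
  simp only [Matrix.add_apply, Matrix.transpose_apply]
  linarith

/-- **(1.8) with a Collatz vector on the symmetrised majorant — the `ρ` of a `passes ≥ 2` run of
`cap.ila.mfldl`.** If `Δ` is symmetric, `|Δ_{ij}| ≤ W_{ij}`, `x > 0`, `0 ≤ ρ` and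
`((W + Wᵀ)x)_i ≤ 2ρ·x_i` for all `i`, then `‖Δv‖₂ ≤ ρ‖v‖₂` for every `v`.
[cite: Rump2026SparseI, (1.8) p. 6] -/
theorem norm_toLp_mulVec_le_of_symm_collatz {Δ W : Matrix (Fin n) (Fin n) ℝ} (hΔ : Δᵀ = Δ)
    (hW : ∀ i j, |Δ i j| ≤ W i j) {x : Fin n → ℝ} (hx : ∀ i, 0 < x i) {ρ : ℝ} (hρ : 0 ≤ ρ)
    (hc : ∀ i, ((W + Wᵀ) *ᵥ x) i ≤ 2 * ρ * x i) (v : Fin n → ℝ) :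
    ‖toLp 2 (Δ *ᵥ v)‖ ≤ ρ * ‖toLp 2 v‖ := by
  -- the symmetrised majorant `S := (W + Wᵀ)/2`
  set S : Matrix (Fin n) (Fin n) ℝ := fun i j => ((W + Wᵀ) i j) / 2 with hS
  have hSW : ∀ i j, |Δ i j| ≤ S i j := fun i j => abs_le_half_add_transpose_of_symm hΔ hW i j
  have hS0 : ∀ i j, 0 ≤ S i j := fun i j => (abs_nonneg _).trans (hSW i j)
  have hSsymm : Sᵀ = S := by
    ext i j
    simp only [hS, Matrix.transpose_apply, Matrix.add_apply]
    ring
  -- `S x ≤ ρ x` componentwise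
  have hSx : ∀ i, (S *ᵥ x) i ≤ ρ * x i := fun i => by
    have h := hc i
    have hsum : (S *ᵥ x) i = ((W + Wᵀ) *ᵥ x) i / 2 := by
      simp only [mulVec, dotProduct, hS, Finset.sum_div]
      refine Finset.sum_congr rfl fun j _ => ?_
      ring
    rw [hsum]
    linarith
  -- `Sᵀ (S x) ≤ ρ² x` by entrywise monotonicity of the nonneg `S`
  have hθ : ∀ k, (Sᵀ *ᵥ (S *ᵥ x)) k ≤ ρ ^ 2 * x k := fun k => by
    rw [hSsymm]
    calc (S *ᵥ (S *ᵥ x)) k = ∑ j, S k j * (S *ᵥ x) j := by simp [mulVec, dotProduct]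
      _ ≤ ∑ j, S k j * (ρ * x j) :=
          sum_le_sum fun j _ => mul_le_mul_of_nonneg_left (hSx j) (hS0 k j)
      _ = ρ * (S *ᵥ x) k := by
          simp only [mulVec, dotProduct, Finset.mul_sum]
          refine Finset.sum_congr rfl fun j _ => ?_
          ring
      _ ≤ ρ * (ρ * x k) := mul_le_mul_of_nonneg_left (hSx k) hρ
      _ = ρ ^ 2 * x k := by ring
  have h := norm_toLp_mulVec_le_sqrt_of_abs_le_collatz hSW hx hθ v
  rwa [Real.sqrt_sq hρ] at h

end Literature.Analysis.Matrix.SparseLUSplit
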